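import Summits.AtomisticToContinuum.Crystallization.Theorems.ReggeStarCoercivityDefectFreeCrystallizesPalmDefs
import Summits.AtomisticToContinuum.Crystallization.Theorems.ChargedEnergyGap.Negative.BlocksBound
import Summits.AtomisticToContinuum.Crystallization.Theorems.ChargedEnergyGap.Negative.BlocksEnergy
import Literature.MathematicalPhysics.StatisticalMechanics.PeriodicConfigurationSums
import Literature.MathematicalPhysics.StatisticalMechanics.MuGSC

/-!
# Junk stripping, energy side (stub JS-E of line `palm-good-law`, crux stmt-AtomisticToContinuum-13603)

Stub `stub_junkStrippingEnergy` of the lead-c3 skeleton `Cruxes/DefectFreeCrystallizes/Lines/palm_good_law.lean` (v11).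
"Junk" = motif sites of a periodic configuration `Q` of `ℝ³` that are not `SetGood` in `Q.points`.  There is an
absolute constant `C ≥ 0` such that every periodic `Q` with at least one `SetGood` motif site has a periodic
sub-configuration `Q'` whose point set is exactly the `SetGood` points of `Q`, whose motif is exactly the `SetGood`
motif sites of `Q`, and with `#motif' · e(Q') ≤ #motif · e(Q) + C · #junk`.

Proof.  `Q' := (Q.lattice, SetGood part of Q.motif)`: `SetGood Q.points` is invariant under the periods of `Q`
(`setGood_add_iff`, as `Q.points` is), so `Q'.points` is the set of `SetGood` points (`exists_subconfiguration`).  ENERGY: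
`2 · #motif · e(Q) = Σ_{x ∈ motif} siteSum_Q(x)` (`Blocks.sum_siteSum_eq`) and every site sum splits over the disjoint
union `Q.points = good ∪ junk` (`siteSum_split`; all lattice sums are absolutely summable,
`PeriodicConfiguration.summable_lennardJones_dist_three`).  The good-good part summed over the good motif sites is
`2 · #motif' · e(Q')`; the junk-junk part summed over the junk motif sites is `2 · #junk · e(Q_junk) ≥ -2 · (2³²/12) · #junk`
for the junk sub-configuration (`Blocks.neg_le_energyPerParticle`, `junk_sum_ge`); the two cross sums are EQUAL
(`cross_eq`: parametrise orbits as `motif × lattice`, `tsum_orbits_eq`, swap the finite sums and re-index the lattice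
sum by `g ↦ -g`), and the one indexed by junk sites is `≥ -(1/6) · 250 · (200/171)⁶ · #junk`, because every point of
`Q` is at distance `≥ 171/200` from every other `SetGood` point (radial pinning `le_dist_of_setGood`: a point at distance
`< 6/5` is a shell point, `1/20`-matched after rescaling by `a ≥ 9/10` to a unit vector) and a `171/200`-separated set
attracts any such point by at most `(1/6) Σ r⁻⁶ ≤ (1/6) · 250 · (200/171)⁶` (`sum_inv_pow_six_le_of_le_dist`,
`neg_le_tsum_lennardJones_of_separated`).  Hence `C = (1/6) · 250 · (200/171)⁶ + 2³²/12` works.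
-/

noncomputable section

open MeasureTheory
open scoped ENNReal BigOperators Classical

namespace Summit.AtomisticToContinuum.Crystallization.Theorems.PalmGoodLaw.JunkStrippingEnergy

open Literature.MathematicalPhysics.StatisticalMechanics Literature.Geometry.DiscreteGeometry MeasureTheory
open Summit.AtomisticToContinuum.Crystallization.Theorems.ChargedEnergyGapNegative -- `E3`, `Blocks.siteSum`, …

/-! ## `SetGood` facts: radial pinning and lattice invariance -/

/-- **Radial pinning at a `SetGood` point.**  Every other point of `S` is at distance `≥ 171/200 = (9/10)·(19/20)`
from a `SetGood` point `y` of `S`: if it lies in the open ball of radius `6/5` about `y`, its rescaled image is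
`1/20`-close to a unit vector of the (rotated) pattern. [folklore] -/
theorem le_dist_of_setGood {S : Set E3} {y z : E3} (h : SetGood S y) (hz : z ∈ S) (hne : z ≠ y) :
    (171 / 200 : ℝ) ≤ dist z y := by
  by_cases hlt : dist z y < 6 / 5
  swap
  · linarith [not_lt.1 hlt]
  obtain ⟨a, ha9, -, T, hT, hclose⟩ := h
  obtain ⟨P, hP1, A, e, he⟩ : ∃ P : Finset E3, (∀ v ∈ P, ‖v‖ = 1) ∧
      ∃ A : E3 →ₗᵢ[ℝ] E3, ∃ e : ↥T ≃ ↥(P.image A), ∀ t : ↥T, dist (t : E3) (e t) ≤ 1 / 20 := by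
    rcases hclose with ⟨A, e, he⟩ | ⟨A, e, he⟩
    · exact ⟨fccKissingPattern, fun v hv => norm_eq_one_of_mem_fccKissingPattern hv, A, e, he⟩
    · exact ⟨hcpKissingPattern, fun v hv => norm_eq_one_of_mem_hcpKissingPattern hv, A, e, he⟩
  have ha0 : 0 < a := by linarith
  have ht : a⁻¹ • (z - y) ∈ T := by
    rw [← Finset.mem_coe, hT]
    exact ⟨z, ⟨hz, hne, hlt⟩, rfl⟩
  obtain ⟨p, hp, hpq⟩ := Finset.mem_image.1 (e ⟨_, ht⟩).2
  have hqn : ‖(e ⟨_, ht⟩ : E3)‖ = 1 := by rw [← hpq, A.norm_map, hP1 p hp]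
  have h1 : |‖a⁻¹ • (z - y)‖ - ‖(e ⟨_, ht⟩ : E3)‖| ≤ 1 / 20 :=
    (abs_norm_sub_norm_le _ _).trans (by simpa [dist_eq_norm] using he ⟨_, ht⟩)
  rw [hqn, norm_smul, norm_inv, Real.norm_of_nonneg ha0.le, abs_le] at h1
  have h3 : a * (19 / 20) ≤ a * (a⁻¹ * ‖z - y‖) := mul_le_mul_of_nonneg_left (by linarith [h1.1]) ha0.le
  rw [← mul_assoc, mul_inv_cancel₀ ha0.ne', one_mul] at h3
  rw [dist_eq_norm]
  linarith

/-- **Lattice invariance of `SetGood` in a periodic point set**: translating the centre by a period does not change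
the recentred shell (`Q.points` is invariant under `± g`). [folklore] -/
theorem setGood_add_iff (Q : PeriodicConfiguration 3) {g : E3} (hg : g ∈ Q.lattice) (y : E3) :
    SetGood Q.points (y + g) ↔ SetGood Q.points y := by
  have hset : ∀ a : ℝ, (fun z : E3 => a⁻¹ • (z - (y + g))) ''
        {z : E3 | z ∈ Q.points ∧ z ≠ y + g ∧ dist z (y + g) < 6 / 5} =
      (fun z : E3 => a⁻¹ • (z - y)) '' {z : E3 | z ∈ Q.points ∧ z ≠ y ∧ dist z y < 6 / 5} := by
    intro a
    ext t
    simp only [Set.mem_image, Set.mem_setOf_eq]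
    constructor
    · rintro ⟨z, ⟨hz, hne, hlt⟩, rfl⟩
      refine ⟨z - g, ⟨?_, fun h => hne (by rw [← h, sub_add_cancel]), ?_⟩, ?_⟩
      · have := Q.add_mem_points hz (Q.lattice.neg_mem hg)
        simpa [sub_eq_add_neg] using this
      · rw [dist_eq_norm] at hlt ⊢
        rwa [sub_sub, add_comm g y]
      · rw [sub_sub, add_comm g y]
    · rintro ⟨z, ⟨hz, hne, hlt⟩, rfl⟩
      refine ⟨z + g, ⟨Q.add_mem_points hz hg, fun h => hne (add_right_cancel h), ?_⟩, ?_⟩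
      · rw [dist_eq_norm] at hlt ⊢
        rwa [add_sub_add_right_eq_sub]
      · rw [add_sub_add_right_eq_sub]
  unfold SetGood
  refine exists_congr fun a => ?_
  rw [hset a]

/-- **Sub-configurations cut out by a lattice-invariant predicate.**  The part of `Q.motif` selected by a
lattice-invariant predicate `pr` (if non-empty), with the periods of `Q`, is a periodic configuration whose point
set is the part of `Q.points` selected by `pr`. [folklore] -/
theorem exists_subconfiguration (Q : PeriodicConfiguration 3) (pr : E3 → Prop)
    (hpr : ∀ g ∈ Q.lattice, ∀ y : E3, pr (y + g) ↔ pr y) {M : Finset E3}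
    (hM : ∀ y : E3, y ∈ M ↔ y ∈ Q.motif ∧ pr y) (hne : M.Nonempty) :
    ∃ Q₁ : PeriodicConfiguration 3, Q₁.points = {x | x ∈ Q.points ∧ pr x} ∧ Q₁.motif = M := by
  refine ⟨⟨Q.lattice, Q.discrete, Q.isZLattice, M, hne,
    fun x hx y hy h => Q.eq_of_sub_mem x ((hM x).1 hx).1 y ((hM y).1 hy).1 h⟩, ?_, rfl⟩
  ext z
  constructor
  · rintro ⟨y, hy, g, hg, rfl⟩
    exact ⟨⟨y, ((hM y).1 hy).1, g, hg, rfl⟩, (hpr g hg y).2 ((hM y).1 hy).2⟩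
  · rintro ⟨⟨y, hy, g, hg, rfl⟩, hz⟩
    exact ⟨y, (hM y).2 ⟨hy, (hpr g hg y).1 hz⟩, g, hg, rfl⟩

/-! ## Lattice-sum bookkeeping -/

/-- `-V_LJ(t) ≤ t⁻⁶/6` (drop the repulsion). [folklore] -/
theorem neg_lennardJones_le (t : ℝ) : -lennardJones t ≤ 1 / 6 * t⁻¹ ^ 6 := by
  unfold lennardJones
  have : 0 ≤ (t⁻¹) ^ 12 := by positivity
  linarith

/-- **Bounded attraction of a separated set.**  If the points of `S` are pairwise `≥ 171/200` apart and all at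
distance `≥ 171/200` from `p`, the (summable) Lennard-Jones field of `S` at `p` is `≥ -(1/6)·250·(200/171)⁶`: every
finite partial sum of `-V_LJ ≤ r⁻⁶/6` is bounded by the shell count `sum_inv_pow_six_le_of_le_dist`. [folklore] -/
theorem neg_le_tsum_lennardJones_of_separated {S : Set E3} {p : E3}
    (hp : ∀ z ∈ S, (171 / 200 : ℝ) ≤ dist p z)
    (hS : ∀ z ∈ S, ∀ w ∈ S, z ≠ w → (171 / 200 : ℝ) ≤ dist z w)
    (hsum : Summable fun z : S => lennardJones (dist p z)) :
    -(1 / 6 * (250 * (171 / 200 : ℝ)⁻¹ ^ 6)) ≤ ∑' z : S, lennardJones (dist p z) := by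
  have key : ∀ F : Finset S, ∑ z ∈ F, -lennardJones (dist p z) ≤ 1 / 6 * (250 * (171 / 200 : ℝ)⁻¹ ^ 6) := by
    intro F
    have h1 : ∑ z ∈ F, -lennardJones (dist p z) ≤ ∑ z ∈ F, 1 / 6 * (dist p (z : E3))⁻¹ ^ 6 :=
      Finset.sum_le_sum fun z _ => neg_lennardJones_le _
    have h2 : ∑ z ∈ F, 1 / 6 * (dist p (z : E3))⁻¹ ^ 6 =
        1 / 6 * ∑ w ∈ F.image Subtype.val, (dist p w)⁻¹ ^ 6 := by
      rw [Finset.mul_sum, Finset.sum_image fun a _ b _ h => Subtype.ext h]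
    have h3 := sum_inv_pow_six_le_of_le_dist (F.image Subtype.val) p (by norm_num : (0 : ℝ) < 171 / 200)
      (fun w hw => by
        obtain ⟨z, -, rfl⟩ := Finset.mem_image.1 hw
        exact hp z z.2)
      (fun w hw w' hw' hne => by
        obtain ⟨z, -, rfl⟩ := Finset.mem_image.1 hw
        obtain ⟨z', -, rfl⟩ := Finset.mem_image.1 hw'
        exact hS z z.2 z' z'.2 hne)
    rw [h2] at h1
    linarith
  have := hsum.neg.tsum_le_of_sum_le key
  rw [tsum_neg] at this
  linarith

/-- Lennard-Jones fields of a periodic configuration of `ℝ³` are summable over every set of its other points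
(`PeriodicConfiguration.summable_lennardJones_dist_three`). [folklore] -/
theorem summable_lennardJones_of_subset (Q : PeriodicConfiguration 3) (p : E3) {s : Set E3}
    (hs : s ⊆ {q : E3 | q ∈ Q.points ∧ q ≠ p}) :
    Summable fun q : s => lennardJones (dist p q) :=
  (Q.summable_lennardJones_dist_three p).comp_injective
    (i := fun q : s => (⟨q.1, hs q.2⟩ : {y : E3 // y ∈ Q.points ∧ y ≠ p}))
    fun a b hab => Subtype.ext (by simpa using congrArg Subtype.val hab)

/-- **Orbit decomposition of lattice sums.**  The points `M + G` over a sub-motif `M` (pairwise inequivalent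
points) are uniquely `y + g`, so a summable function sums over `M + G` as `Σ_{y ∈ M} Σ'_{g ∈ G}`. [folklore] -/
theorem tsum_orbits_eq (Q : PeriodicConfiguration 3) {M : Finset E3} (hM : M ⊆ Q.motif) (φ : E3 → ℝ)
    (hφ : Summable fun u : {z : E3 // ∃ y ∈ M, ∃ g ∈ Q.lattice, z = y + g} => φ u) :
    ∑' u : {z : E3 // ∃ y ∈ M, ∃ g ∈ Q.lattice, z = y + g}, φ u =
      ∑ y ∈ M, ∑' g : Q.lattice, φ (y + g) := by
  let f : ↥M × ↥Q.lattice → {z : E3 // ∃ y ∈ M, ∃ g ∈ Q.lattice, z = y + g} :=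
    fun q => ⟨(q.1 : E3) + (q.2 : E3), q.1, q.1.2, q.2, q.2.2, rfl⟩
  have hf : Function.Bijective f := by
    constructor
    · rintro ⟨y, g⟩ ⟨y', g'⟩ h
      have h' : (y : E3) + g = y' + g' := congrArg Subtype.val h
      have hsub : (y : E3) - y' = g' - g := by
        rw [sub_eq_sub_iff_add_eq_add, h', add_comm]
      have hmem : (y : E3) - y' ∈ Q.lattice := by
        rw [hsub]; exact Q.lattice.sub_mem g'.2 g.2
      have hy : (y : E3) = y' := Q.eq_of_sub_mem _ (hM y.2) _ (hM y'.2) hmem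
      have hg : (g : E3) = g' := by
        rw [hy] at h'; exact add_left_cancel h'
      exact Prod.ext (Subtype.ext hy) (Subtype.ext hg)
    · rintro ⟨z, y, hy, g, hg, rfl⟩
      exact ⟨(⟨y, hy⟩, ⟨g, hg⟩), rfl⟩
  let e : ↥M × ↥Q.lattice ≃ {z : E3 // ∃ y ∈ M, ∃ g ∈ Q.lattice, z = y + g} := Equiv.ofBijective f hf
  rw [← e.tsum_eq]
  have hsum : Summable fun q : ↥M × ↥Q.lattice => φ (e q) := e.summable_iff.2 hφ
  rw [hsum.tsum_prod' (fun b => hsum.prod_factor b), tsum_fintype,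
    ← Finset.sum_coe_sort M (fun y => ∑' g : Q.lattice, φ (y + g))]
  rfl

/-- **Splitting a site sum** of `Q` into the field of the `SetGood` points and the field of the other ("junk")
points (`tsum` over a disjoint union of two summable pieces). [folklore] -/
theorem siteSum_split (Q : PeriodicConfiguration 3) (p : E3) :
    Blocks.siteSum Q lennardJones p =
      ∑' q : {q : E3 // (q ∈ Q.points ∧ SetGood Q.points q) ∧ q ≠ p}, lennardJones (dist p q) +
        ∑' q : {q : E3 // (q ∈ Q.points ∧ ¬ SetGood Q.points q) ∧ q ≠ p}, lennardJones (dist p q) := by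
  have hdisj : Disjoint {q : E3 | (q ∈ Q.points ∧ SetGood Q.points q) ∧ q ≠ p}
      {q : E3 | (q ∈ Q.points ∧ ¬ SetGood Q.points q) ∧ q ≠ p} :=
    Set.disjoint_left.2 fun q hq hq' => hq'.1.2 hq.1.2
  have h := Summable.tsum_union_disjoint (f := fun q : E3 => lennardJones (dist p q)) hdisj
    (summable_lennardJones_of_subset Q p fun q hq => ⟨hq.1.1, hq.2⟩)
    (summable_lennardJones_of_subset Q p fun q hq => ⟨hq.1.1, hq.2⟩)
  refine Eq.trans ?_ h
  unfold Blocks.siteSum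
  refine tsum_congr_subtype (fun q : E3 => lennardJones (dist p q)) fun q => ?_
  simp only [Set.mem_union, Set.mem_setOf_eq]
  tauto

/-- **Fields orbit by orbit.**  For a lattice-invariant predicate `pr` with `pr`-motif `M` and a point `p` with
`¬ pr p`, the field at `p` of the `pr`-points of `Q` is `Σ_{y ∈ M} Σ'_{g ∈ G} V(|p - (y + g)|)` (`tsum_orbits_eq`).
[folklore] -/
theorem field_eq_sum_orbits (Q : PeriodicConfiguration 3) (pr : E3 → Prop)
    (hpr : ∀ g ∈ Q.lattice, ∀ y : E3, pr (y + g) ↔ pr y) {M : Finset E3}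
    (hM : ∀ y : E3, y ∈ M ↔ y ∈ Q.motif ∧ pr y) {p : E3} (hp : ¬ pr p) :
    ∑' q : {q : E3 // (q ∈ Q.points ∧ pr q) ∧ q ≠ p}, lennardJones (dist p q) =
      ∑ y ∈ M, ∑' g : Q.lattice, lennardJones (dist p (y + g)) := by
  have hiff : ∀ q : E3, ((q ∈ Q.points ∧ pr q) ∧ q ≠ p) ↔ ∃ y ∈ M, ∃ g ∈ Q.lattice, q = y + g := by
    intro q
    constructor
    · rintro ⟨⟨⟨y, hy, g, hg, rfl⟩, hq⟩, -⟩
      exact ⟨y, (hM y).2 ⟨hy, (hpr g hg y).1 hq⟩, g, hg, rfl⟩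
    · rintro ⟨y, hy, g, hg, rfl⟩
      have hq : pr (y + g) := (hpr g hg y).2 ((hM y).1 hy).2
      exact ⟨⟨Q.add_mem_points (Q.mem_points_of_mem_motif ((hM y).1 hy).1) hg, hq⟩, fun h => hp (h ▸ hq)⟩
  rw [tsum_congr_subtype (fun q : E3 => lennardJones (dist p q)) hiff]
  exact tsum_orbits_eq Q (fun y hy => ((hM y).1 hy).1) (fun q : E3 => lennardJones (dist p q))
    (summable_lennardJones_of_subset Q p fun q hq => ⟨((hiff q).2 hq).1.1, ((hiff q).2 hq).2⟩)

/-- **The two cross sums coincide.**  `Σ_{x good motif} Σ'_{junk points} V(|x - q|) = Σ_{z junk motif} Σ'_{good points}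
V(|z - q|)`: both are `Σ_{x good} Σ_{z junk} Σ'_{g ∈ G} V(|x - z - g|)` after parametrising the orbits
(`field_eq_sum_orbits`) and re-indexing `g ↦ -g`. [folklore] -/
theorem cross_eq (Q : PeriodicConfiguration 3) :
    ∑ x ∈ Q.motif.filter (fun x => SetGood Q.points x),
        ∑' q : {q : E3 // (q ∈ Q.points ∧ ¬ SetGood Q.points q) ∧ q ≠ x}, lennardJones (dist x q) =
      ∑ z ∈ Q.motif.filter (fun x => ¬ SetGood Q.points x),
        ∑' q : {q : E3 // (q ∈ Q.points ∧ SetGood Q.points q) ∧ q ≠ z}, lennardJones (dist z q) := by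
  rw [Finset.sum_congr rfl fun x hx => field_eq_sum_orbits Q (fun x => ¬ SetGood Q.points x)
      (fun g hg y => not_congr (setGood_add_iff Q hg y)) (fun y => Finset.mem_filter)
      (not_not.2 (Finset.mem_filter.1 hx).2),
    Finset.sum_congr rfl fun z hz => field_eq_sum_orbits Q (fun x => SetGood Q.points x)
      (fun g hg y => setGood_add_iff Q hg y) (fun y => Finset.mem_filter) (Finset.mem_filter.1 hz).2,
    Finset.sum_comm]
  refine Finset.sum_congr rfl fun z _ => Finset.sum_congr rfl fun x _ => ?_
  rw [← (Equiv.neg ↥Q.lattice).tsum_eq]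
  refine tsum_congr fun g => ?_
  simp only [Equiv.neg_apply, NegMemClass.coe_neg]
  rw [dist_comm x, dist_eq_norm, dist_eq_norm]
  congr 2
  abel

/-- **The junk-junk part is the energy of the junk sub-configuration**, hence `≥ 2 · #junk · (-2³²/12)`
(`Blocks.neg_le_energyPerParticle` for `(Q.lattice, junk part of Q.motif)`; trivial if there is no junk). [folklore] -/
theorem junk_sum_ge (Q : PeriodicConfiguration 3) :
    2 * ((Q.motif.filter fun x => ¬ SetGood Q.points x).card : ℝ) * (-(65536 ^ 2 / 12 : ℝ)) ≤
      ∑ z ∈ Q.motif.filter (fun x => ¬ SetGood Q.points x),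
        ∑' q : {q : E3 // (q ∈ Q.points ∧ ¬ SetGood Q.points q) ∧ q ≠ z}, lennardJones (dist z q) := by
  set J := Q.motif.filter (fun x => ¬ SetGood Q.points x) with hJ
  rcases J.eq_empty_or_nonempty with hJe | hJne
  · simp [hJe]
  · -- the junk sub-configuration
    obtain ⟨QJ, hpts, hmotif⟩ := exists_subconfiguration Q (fun x => ¬ SetGood Q.points x)
      (fun g hg y => not_congr (setGood_add_iff Q hg y)) (fun y => by rw [hJ, Finset.mem_filter]) hJne
    have hsite : ∀ z : E3, Blocks.siteSum QJ lennardJones z =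
        ∑' q : {q : E3 // (q ∈ Q.points ∧ ¬ SetGood Q.points q) ∧ q ≠ z}, lennardJones (dist z q) := by
      intro z
      unfold Blocks.siteSum
      exact tsum_congr_subtype (fun q : E3 => lennardJones (dist z q)) fun q => by rw [hpts]; rfl
    have hsum := Blocks.sum_siteSum_eq QJ lennardJones
    have hlow := Blocks.neg_le_energyPerParticle QJ
    rw [hmotif, Finset.sum_congr rfl fun z _ => hsite z] at hsum
    rw [hsum]
    have h0 : (0 : ℝ) ≤ 2 * (J.card : ℝ) := by positivity
    nlinarith [mul_le_mul_of_nonneg_left hlow h0]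

/-- Every `SetGood`-field at a point of `Q` is `≥ -(1/6)·250·(200/171)⁶`: the `SetGood` points of `Q` are pairwise
`≥ 171/200` apart and `≥ 171/200` from every other point of `Q` (`le_dist_of_setGood`). [folklore] -/
theorem neg_le_goodField (Q : PeriodicConfiguration 3) {p : E3} (hp : p ∈ Q.points) :
    -(1 / 6 * (250 * (171 / 200 : ℝ)⁻¹ ^ 6)) ≤
      ∑' q : {q : E3 // (q ∈ Q.points ∧ SetGood Q.points q) ∧ q ≠ p}, lennardJones (dist p q) :=
  neg_le_tsum_lennardJones_of_separated (S := {q : E3 | (q ∈ Q.points ∧ SetGood Q.points q) ∧ q ≠ p})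
    (fun _ hz => le_dist_of_setGood hz.1.2 hp hz.2.symm)
    (fun _ hz _ hw hne => le_dist_of_setGood hw.1.2 hz.1.1 hne)
    (summable_lennardJones_of_subset Q p fun _ hq => ⟨hq.1.1, hq.2⟩)

/-! ## The energy estimate and the stub -/

/-- **Energy of the `SetGood` sub-configuration.**  If `Q'` has point set the `SetGood` points of `Q` and motif the
`SetGood` motif sites of `Q`, then `#motif' · e(Q') ≤ #motif · e(Q) + C · #junk` with
`C = (1/6)·250·(200/171)⁶ + 2³²/12`. [folklore] -/
theorem card_mul_energy_le (Q Q' : PeriodicConfiguration 3)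
    (hpts : Q'.points = {x | x ∈ Q.points ∧ SetGood Q.points x})
    (hmotif : (↑Q'.motif : Set E3) = {x | x ∈ Q.motif ∧ SetGood Q.points x}) :
    (Q'.motif.card : ℝ) * Q'.energyPerParticle lennardJones ≤
      (Q.motif.card : ℝ) * Q.energyPerParticle lennardJones +
        (1 / 6 * (250 * (171 / 200 : ℝ)⁻¹ ^ 6) + 65536 ^ 2 / 12) *
          (Nat.card {x : Q.motif // ¬ SetGood Q.points (x : E3)} : ℝ) := by
  set M' := Q.motif.filter (fun x => SetGood Q.points x) with hM'
  set J := Q.motif.filter (fun x => ¬ SetGood Q.points x) with hJ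
  have hQ'motif : Q'.motif = M' := by
    apply Finset.coe_injective
    rw [hmotif, hM', Finset.coe_filter]
  have hcard : (Nat.card {x : Q.motif // ¬ SetGood Q.points (x : E3)} : ℝ) = J.card := by
    congr 1
    rw [Nat.card_congr (Equiv.subtypeSubtypeEquivSubtypeInter (fun x : E3 => x ∈ Q.motif)
      (fun x : E3 => ¬ SetGood Q.points x))]
    exact Nat.subtype_card J fun x => by rw [hJ, Finset.mem_filter]
  -- the two fields
  set T' : E3 → ℝ := fun p =>
    ∑' q : {q : E3 // (q ∈ Q.points ∧ SetGood Q.points q) ∧ q ≠ p}, lennardJones (dist p q)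
  set TJ : E3 → ℝ := fun p =>
    ∑' q : {q : E3 // (q ∈ Q.points ∧ ¬ SetGood Q.points q) ∧ q ≠ p}, lennardJones (dist p q)
  have h1 : ∀ p : E3, Blocks.siteSum Q lennardJones p = T' p + TJ p := fun p => siteSum_split Q p
  have h2 : ∀ p : E3, Blocks.siteSum Q' lennardJones p = T' p := by
    intro p
    unfold Blocks.siteSum
    exact tsum_congr_subtype (fun q : E3 => lennardJones (dist p q)) fun q => by rw [hpts]; rfl
  have hQ : 2 * (Q.motif.card : ℝ) * Q.energyPerParticle lennardJones =
      (∑ p ∈ M', T' p + ∑ p ∈ J, T' p) + (∑ p ∈ M', TJ p + ∑ p ∈ J, TJ p) := by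
    rw [← Blocks.sum_siteSum_eq, Finset.sum_congr rfl fun p _ => h1 p, Finset.sum_add_distrib,
      Finset.sum_filter_add_sum_filter_not, Finset.sum_filter_add_sum_filter_not]
  have hQ' : 2 * (Q'.motif.card : ℝ) * Q'.energyPerParticle lennardJones = ∑ p ∈ M', T' p := by
    rw [← Blocks.sum_siteSum_eq, hQ'motif]
    exact Finset.sum_congr rfl fun p _ => h2 p
  have hB : -(1 / 6 * (250 * (171 / 200 : ℝ)⁻¹ ^ 6)) * J.card ≤ ∑ p ∈ J, T' p := by
    have := Finset.card_nsmul_le_sum J T' (-(1 / 6 * (250 * (171 / 200 : ℝ)⁻¹ ^ 6)))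
      fun p hp => neg_le_goodField Q (Q.mem_points_of_mem_motif (Finset.mem_filter.1 hp).1)
    rwa [nsmul_eq_mul, mul_comm] at this
  have hA : ∑ p ∈ M', TJ p = ∑ p ∈ J, T' p := cross_eq Q
  have hD : 2 * (J.card : ℝ) * (-(65536 ^ 2 / 12 : ℝ)) ≤ ∑ p ∈ J, TJ p := junk_sum_ge Q
  rw [hcard]
  linarith

/-- **Stub `stub_junkStrippingEnergy` (JS-E) of line `palm-good-law`.**  JUNK STRIPPING, ENERGY SIDE: with
`C = (1/6)·250·(200/171)⁶ + 2³²/12`, every periodic configuration `Q` of `ℝ³` with a `SetGood` motif site has the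
periodic sub-configuration `Q' = (Q.lattice, SetGood part of Q.motif)` with point set the `SetGood` points of `Q`
(`setGood_add_iff`, `exists_subconfiguration`), motif the `SetGood` motif sites, and `#motif' · e(Q') ≤ #motif · e(Q) + C · #junk`
(`card_mul_energy_le`). [folklore] -/
theorem stub_junkStrippingEnergy :
    ∃ C : ℝ, 0 ≤ C ∧ ∀ Q : Literature.MathematicalPhysics.StatisticalMechanics.PeriodicConfiguration 3,
      (∃ x ∈ Q.motif, SetGood Q.points x) →
      ∃ Q' : Literature.MathematicalPhysics.StatisticalMechanics.PeriodicConfiguration 3,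
        Q'.points = {x | x ∈ Q.points ∧ SetGood Q.points x} ∧
        (↑Q'.motif : Set (EuclideanSpace ℝ (Fin 3))) = {x | x ∈ Q.motif ∧ SetGood Q.points x} ∧
        (Q'.motif.card : ℝ) * Q'.energyPerParticle lennardJones ≤
          (Q.motif.card : ℝ) * Q.energyPerParticle lennardJones +
            C * (Nat.card {x : Q.motif // ¬ SetGood Q.points (x : EuclideanSpace ℝ (Fin 3))} : ℝ) := by
  refine ⟨1 / 6 * (250 * (171 / 200 : ℝ)⁻¹ ^ 6) + 65536 ^ 2 / 12, by positivity, fun Q hQ => ?_⟩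
  obtain ⟨x₀, hx₀, hgood₀⟩ := hQ
  obtain ⟨Q', hpts, hmotif⟩ := exists_subconfiguration Q (fun x => SetGood Q.points x)
    (fun g hg y => setGood_add_iff Q hg y) (fun y => Finset.mem_filter) ⟨x₀, Finset.mem_filter.2 ⟨hx₀, hgood₀⟩⟩
  have hmotif' : (↑Q'.motif : Set E3) = {x | x ∈ Q.motif ∧ SetGood Q.points x} := by
    rw [hmotif, Finset.coe_filter]
  exact ⟨Q', hpts, hmotif', card_mul_energy_le Q Q' hpts hmotif'⟩

end Summit.AtomisticToContinuum.Crystallization.Theorems.PalmGoodLaw.JunkStrippingEnergy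

end
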